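import Summits.BirchSwinnertonDyer.BirchSwinnertonDyer.Theorems.PrintX11aLowerHalfOddPrimeStub
import Literature.NumberTheory.EllipticCurves.EmertonPollackWeston2006.MultiplicativeToGoodOrdinaryOddPrime
import Literature.NumberTheory.EllipticCurves.Rank1Residual.X10bMuInvariant
import Literature.NumberTheory.EllipticCurves.KrausOesterle1992.TorsionCongruenceCriterionHasseWeil
import HarnessLib

/-!
# Crux `X11aLowerHalf` (item stmt-BirchSwinnertonDyer-19064) at `p = 3`: the WEIGHT-TWO PARTNER road — the
# lower half at an X11a pair with `p = 3` from a `3`-congruent GOOD ORDINARY partner and named facts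
# (`--supports stmt-BirchSwinnertonDyer-19064` helper; seat bsd-line-er5-p2 = -w3 width seat of the 19064 line,
# registered stub `stub_memberRatEqAtThree` of line birth r4, FINITE-FLAT off-Kodaira sub-locus)

HONEST FRAMING. Theorems only; no definition, no new named fact minted here, no `sorry`; NO route file
imported. Every theorem is CONDITIONAL on displayed named facts (never "proved") and on displayed PER-PAIR
partner data; nothing here closes the crux, the registered stub, or any class. BSD is proved for no curve by
this file. beyond-print theorem: no.

## Why (the `p = 3` map after g2/g3, file `pub/bsd-stepL/line-er5-p2/g3/KODAIRA-MEMBER.md` §6)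

At a deep X11a pair with `p = 3` (`r_an = 0`, `3 ‖ N`, `E[3]` irreducible, no (ram) prime, `3 ∣ #Ш_an`) the
registered stub asks for ONE good-ordinary Hida member of `H(E[3])` with the RATIONAL cyclotomic equality
(`OddChain.MemberRatEqAt W 3`). g3 closed it on the KODAIRA sub-locus (91 of 448 deep classes with `N < 5·10⁵`:
an additive place of type IV/IV* manufactures Skinner–Urban's (ram) prime for a level-lowered member,
p621194/p620825/p623401). OFF that sub-locus no member of `H(E[3])` has a (ram) prime, and the weight-`k > 2`
sources (X. Wan 2015 Thm. 4: "`p ⩾ 5`"; Burungale–Castella–Skinner 2025: `p > 3`) do not print `3`. The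
one (ram)-FREE source that prints `p > 2` is for WEIGHT TWO: Yan–Zhu, J. Algebra 693 (2026) Thm. 4.9 (=
v4 Thm. 5.2) — the rational cyclotomic main conjecture for an ELLIPTIC CURVE good ordinary at `p > 2` with
irreducible `E[p]` (tree fact `YanZhu2026.thm49_charIdeal_eq_padicLFunction`, cell flag `YZ26@3-BF-ERL-Ohta`).
A weight-two member of `H(E[3])` of level prime to `3` is (the `3`-stabilisation of) the newform of an
elliptic curve `A/ℚ` GOOD ORDINARY at `3` with `A[3] ≃ E[3]` — a PARTNER; it exists only if `E[3]|_{G_{ℚ₃}}`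
is finite flat (`3 ∣ v₃(Δ_min)`, the peu-ramifié case; 71 of the 357 off-Kodaira deep classes), never on
the très-ramifié remainder (286 classes; REF g14's `Negative/GoodOrdinaryPartnerTresRamifie.lean` is the
`p ≥ 5` statement of this obstruction). THIS FILE: given such a partner (displayed per-pair data, or a finite
Kraus–Oesterlé congruence list), the LOWER HALF at the pair follows from named facts — Emerton–Pollack–Weston
2006 Thm. 1 (`∗ = alg`, `∗ = an`) and Cor. 5.1.4 at an ODD prime (Literature
`EmertonPollackWeston2006/MultiplicativeToGoodOrdinaryOddPrime.lean`, this seat), Yan–Zhu Thm. 4.9, the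
period unit at `3`, and the E-side facts the chain of record already uses (Kato's side, Mazur's Manin
constant, Stein–Wuthrich 6.1, GZK, Greenberg–Stevens, modularity).

## The road (every arrow a tree theorem; inputs named)

`μ^an(E,3) = 0` (x11a-p2's `MultThreeMuAn.muAnZeroAt_three_of_mult_of_irr`, mod Mazur Cor. 4.1) + the typed
divisibility `X11b.MultDivisibilityAt W 3` (Kato–Wuthrich A32 + Lemma 20 under `Surj`; Kato 12.4 ∕ §17.13 ∕
Greenberg 1.5 ∕ Wuthrich Cor. 18 otherwise) ⟹ `μ^alg(E) = 0`
(`NonSurjChain.isTorsion_and_mu_eq_zero_of_muAnZeroAt_of_multDivisibilityAt`) ⟹[EPW Thm. 1 alg ∕ an,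
mult ⟶ good, odd `p`] `μ^alg(A) = μ^an(A) = 0` ⟹[Yan–Zhu 4.9 rational + Greenberg–Vatsal 3.7 integrality
(`padicLFunction_mem_integral_holds`) + `exponent_eq_zero_of_hasUnitContent`] the INTEGRAL identity with
`μ = 0` at `A`, `GoodOrdinaryCharIdealMuZero A 3` ⟹[EPW Cor. 5.1.4, good ⟶ mult, odd `p`]
`MultiplicativeCharIdealMuZero W 3` ⟹ `X2.MazurMainConjectureAt W 3` (drop `μ`; `ϖ ≠ 0` is automatic) ⟹
`BSD(E,3)` (height-free socket `bsdp_of_mazurMainConjectureAt_heightFree`) ⟹ `Typed.MissingLowerBoundAt W 3`.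

## What

* §0 `cor514_transfer_of_goodOrdinary_of_odd`, `norm_periodRatio_eq_one_three` — bookkeeping.
* §1 `goodOrdinaryCharIdealMuZero_three_of_partner` — the partner's integral identity with `μ = 0`.
* §2 `multiplicativeCharIdealMuZero_three_of_partner`, `mazurMainConjectureAt_of_multiplicativeCharIdealMuZero`.
* §3 `ClassX11a.missingLowerBoundAt_three_of_partner_of_multDivisibilityAt` ∕ `…_of_surj` ∕ `…_of_not_surj` ∕
  `…_of_facts` (image-free) — THE LOWER HALF at an X11a pair with `p = 3` and a partner.
* §4 `ClassX11a.missingLowerBoundAt_three_of_partner_of_congruences_of_facts` — the partner's `A[3] ≃ E[3]`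
  from a finite Kraus–Oesterlé congruence list (`prop4_torsionIso_of_congruences_hasseWeil`).
Class-level turnkeys for the line's lead (stub shapes, the cut Kodaira ∕ finite-flat-partner ∕ très-ramifié)
are in the sequel `PrintX11aLowerHalfThreePartnerByName.lean`.

References: [EmertonPollackWeston2006] Thm. 1, Thm. 3.1.1, Thm. 5.1.3, Cor. 5.1.4, Notation p. 5, Ex. 5.3.1–2;
[YanZhu2024MainConjNonCM] Thm. 4.9 (v4 Thm. 5.2); [GreenbergVatsal2000] §3 Prop. (3.1), Remark (3.4), Prop.
(3.7); [Mazur1978] Cor. 4.1; [KrausOesterle1992] Prop. 4; [SteinWuthrich2013] Thm. 6.1; [Wuthrich2014] Cor. 18,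
Lemma 20; [Kato2004Asterisque] Thm. 12.4, §17.13; [Miller2011LMS] Def. 1.1; cell files
`pub/bsd-stepL/line-er5-p2/` (g2 P3-LOWER-AUDIT.md, g3 KODAIRA-MEMBER.md, g4 NOTES).
-/

set_option autoImplicit false
set_option linter.dupNamespace false -- the directory name repeats the summit name (sibling precedent)

noncomputable section

open scoped Classical MatrixGroups ModularForm

open CongruenceSubgroup UpperHalfPlane WeierstrassCurve Literature.NumberTheory.EllipticCurves
  Literature.NumberTheory.EllipticCurves.ModularForms
  Literature.NumberTheory.EllipticCurves.Rank1Residual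
  Literature.NumberTheory.EllipticCurves.Rank1Residual.Typed
  Literature.NumberTheory.EllipticCurves.Wuthrich2014
  Literature.NumberTheory.EllipticCurves.SteinWuthrich2013
  Literature.NumberTheory.EllipticCurves.Greenberg1999
  Literature.NumberTheory.EllipticCurves.Kato2004
  Literature.NumberTheory.EllipticCurves.GreenbergVatsal2000
  Literature.NumberTheory.EllipticCurves.EmertonPollackWeston2006
  Literature.NumberTheory.GaloisRepresentations
  Summit.BirchSwinnertonDyer.Rank1Residual
  Summit.BirchSwinnertonDyer.Rank1Residual.X11a

namespace Summit.BirchSwinnertonDyer.BirchSwinnertonDyer.Theorems.ThreePartner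

/-! ### §0 Bookkeeping -/

/-- The `5 ≤ p` fact `cor514_transfer_of_goodOrdinary` (`HidaFamilyTransfer.lean`) from its odd-prime twin
(`5 ≤ p ⟹ p ≠ 2`; deprecate-and-add bookkeeping, proved here because the Literature statement-only lane takes no
proof bodies). [cite: EmertonPollackWeston2006, Cor. 5.1.4 (arXiv:math/0404484 p. 30)] -/
theorem cor514_transfer_of_goodOrdinary_of_odd (h : cor514_transfer_of_goodOrdinary_odd) :
    cor514_transfer_of_goodOrdinary := by
  intro W₁ W₂ _ _ _ _ p _ hp5
  exact h W₁ W₂ p (by omega)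

/-- For a curve GOOD at `3` with `E[3]` irreducible and a newform `f` of it, the rational `ϖ` with
`ϖ·Ω_E = Ω⁺_f` is a `3`-adic unit — from the named fact `realPeriodRat_eq_unit_mul_plusPeriod_three`
(`Ω_E = u·Ω⁺_f`, `‖u‖₃ = 1`) and `Ω⁺_f > 0`. (The `p`-generic `norm_periodRatio_eq_one_of_odd` also wants the
`p ≥ 5` fact; at `3` only this one is used.) [cite: GreenbergVatsal2000, §3 Remark (3.4)] [cite: Mazur1978, Cor. 4.1] -/
theorem norm_periodRatio_eq_one_three (h3 : realPeriodRat_eq_unit_mul_plusPeriod_three)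
    (A : WeierstrassCurve ℚ) [A.IsElliptic] [A.IsGloballyMinimal] (hgood : A.HasGoodReductionAtPrime 3)
    (hirr : A.HasIrreducibleModPGaloisRep 3) {N : ℕ} [NeZero N] (f : CuspForm (Gamma0 N) 2)
    (hf : IsNewformOf A f) (ϖ : ℚ) (hϖeq : (ϖ : ℝ) * A.realPeriodRat = plusPeriod f) :
    ‖(ϖ : ℚ_[3])‖ = 1 := by
  have hplus : plusPeriod f ≠ 0 := (IsNewform0.plusPeriod_pos_holds hf.1 hf.coeffField_eq_bot).ne'
  obtain ⟨u, hu1, huΩ⟩ := h3 A hgood hirr f hf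
  have hϖu : ϖ * u = 1 := by
    have h1 : ((ϖ * u : ℚ) : ℝ) * plusPeriod f = ((1 : ℚ) : ℝ) * plusPeriod f := by
      calc ((ϖ * u : ℚ) : ℝ) * plusPeriod f = (ϖ : ℝ) * ((u : ℝ) * plusPeriod f) := by
            push_cast; ring
        _ = (ϖ : ℝ) * A.realPeriodRat := by rw [← huΩ]
        _ = plusPeriod f := hϖeq
        _ = ((1 : ℚ) : ℝ) * plusPeriod f := by push_cast; rw [one_mul]
    exact_mod_cast mul_right_cancel₀ hplus h1
  have h := congrArg (fun r : ℚ => ‖(r : ℚ_[3])‖) hϖu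
  simp only [Rat.cast_mul, norm_mul, hu1, mul_one, Rat.cast_one, norm_one] at h
  exact h

/-! ### §1 The partner's integral main-conjecture identity with `μ = 0` -/

section Partner

variable (W A : WeierstrassCurve ℚ) [W.IsElliptic] [W.IsGloballyMinimal] [A.IsElliptic]
  [A.IsGloballyMinimal]

/-- **`GoodOrdinaryCharIdealMuZero A 3` for a good-ordinary `3`-congruent partner `A` of a curve `E = W`
MULTIPLICATIVE at `3` with `E[3]` irreducible, `μ^an(E,3) = 0` (`hμ`) and the typed divisibility at `(E,3)`
(`hdiv`).** Data: `A` globally minimal, good ordinary at `3` (`hgoodA`, `hordA`), a `Γ_ℚ`-equivariant additive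
isomorphism `E[3] ≃ A[3]` (`hiso`). Facts: Yan–Zhu Thm. 4.9 (`hYZ`, flag `YZ26@3-BF-ERL-Ohta`), the period unit
at `3` (`h3`), EPW Thm. 1 at an odd prime, mult ⟶ good, `∗ = alg` (`hTa`) and `∗ = an` (`hTn`), a modular
parametrisation (`hpar`). Route: `μ^alg(E) = 0` from `hdiv` + `hμ`; both `μ`'s move to `A`; at `A` the rational
identity `ι g = p^k·L` has `k = 0` because `g` has unit content, `L = L_3(f_A, α)` is integral (Greenberg–Vatsal
3.7, tree theorem) and has a unit coefficient; rescale by the unit `ϖ`. CONDITIONAL; per pair.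
[cite: YanZhu2024MainConjNonCM, Thm. 4.9 (§4.4 of arXiv:2412.20078v2; v4 Thm. 5.2)]
[cite: EmertonPollackWeston2006, Thm. 1 (arXiv:math/0404484 p. 2), Thm. 3.1.1 (p. 17)]
[cite: GreenbergVatsal2000, Prop. (3.7) and §3 Remark (3.4)] -/
theorem goodOrdinaryCharIdealMuZero_three_of_partner
    (hYZ : YanZhu2026.thm49_charIdeal_eq_padicLFunction) (h3 : realPeriodRat_eq_unit_mul_plusPeriod_three)
    (hTa : thm1_muAlg_transfer_goodOrdinary_of_mult_odd) (hTn : thm1_muAn_transfer_goodOrdinary_of_mult_odd)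
    (hpar : nonempty_modularParametrizationData)
    (hmult : W.HasMultiplicativeReductionAtPrime 3) (hirr : W.HasIrreducibleModPGaloisRep 3)
    (hdiv : X11b.MultDivisibilityAt W 3) (hμ : X11a.MuAnZeroAt W 3)
    (hgoodA : A.HasGoodReductionAtPrime 3) (hordA : ¬ ((3 : ℕ) : ℤ) ∣ A.frobeniusTrace 3)
    (hiso : ∃ e : geomTorsion W ((3 : ℕ) : ℤ) ≃+ geomTorsion A ((3 : ℕ) : ℤ),
      ∀ (σ : Field.absoluteGaloisGroup ℚ) (P : geomTorsion W ((3 : ℕ) : ℤ)), e (σ • P) = σ • e P) :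
    GoodOrdinaryCharIdealMuZero A 3 := by
  have h32 : (3 : ℕ) ≠ 2 := by decide
  obtain ⟨e, he⟩ := hiso
  have hirrA : A.HasIrreducibleModPGaloisRep 3 := hasIrreducibleModPGaloisRep_of_torsionIso e he hirr
  -- `μ^alg(E) = 0` (Kato's side + the certificate), then `μ^alg(A) = 0` (EPW Thm. 1, ∗ = alg)
  have hμalgE : ∀ (κ : ZpExtension ℚ 3) (γ : Field.absoluteGaloisGroup ℚ), κ.IsCyclotomic →
      κ.IsTopGenerator γ → IsCyclotomicVariable 3 γ →
      ∀ D : W.SelmerDualData κ γ, D.IsTorsion ∧ D.mu = 0 :=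
    fun κ γ hκ hγ hγ' D =>
      NonSurjChain.isTorsion_and_mu_eq_zero_of_muAnZeroAt_of_multDivisibilityAt W 3 hpar hmult hdiv hμ hκ hγ
        hγ' D
  have hμalgA := hTa W A 3 h32 hmult hgoodA hordA ⟨e, he⟩ hirr hμalgE
  intro κ γ hκ hγ hγ' _ f hf ϖ hϖeq D
  have hϖnorm : ‖(ϖ : ℚ_[3])‖ = 1 := norm_periodRatio_eq_one_three h3 A hgoodA hirrA f hf ϖ hϖeq
  -- `μ^an(A) = 0`, Néron-normalised (EPW Thm. 1, ∗ = an), at this newform and period ratio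
  have hcertϖ : ∃ n : ℕ, ‖PowerSeries.coeff n
      (PowerSeries.C (ϖ : ℚ_[3]) * padicLFunction f (unitRoot A 3 : ℚ_[3]))‖ = 1 :=
    hTn W A 3 h32 hmult hgoodA hordA ⟨e, he⟩ hirr hμ f hf ϖ hϖeq
  -- the rational identity at `A` (Yan–Zhu 4.9) upgraded
  have hcert : ∃ n : ℕ, ‖PowerSeries.coeff n (padicLFunction f (unitRoot A 3 : ℚ_[3]))‖ = 1 := by
    obtain ⟨n, hn⟩ := hcertϖ
    refine ⟨n, ?_⟩
    rwa [PowerSeries.coeff_C_mul, norm_mul, hϖnorm, one_mul] at hn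
  obtain ⟨hX, g, hchar, hιg⟩ :=
    mazurMainConjecture_of_mu_eq_zero_of_rationalMC A 3 (rationalMC_of_yanZhu A 3 hYZ h32 hgoodA hordA hirrA)
      h32 hgoodA hordA hirrA κ γ hκ hγ hγ' f hf D (hμalgA κ γ hκ hγ hγ' D).2 hcert
  -- rescale the generator by the unit `ϖ ∈ ℤ₃ˣ`
  set c : ℤ_[3] := ⟨(ϖ : ℚ_[3]), hϖnorm.le⟩ with hc_def
  have hcu : IsUnit c := PadicInt.isUnit_iff.mpr hϖnorm
  have hιcg : iwasawaToPowerSeries 3 (PowerSeries.C c * g) =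
      PowerSeries.C (ϖ : ℚ_[3]) * padicLFunction f (unitRoot A 3 : ℚ_[3]) := by
    rw [map_mul, hιg, PowerSeries.map_C]
    rfl
  refine ⟨hX, PowerSeries.C c * g, ?_, hasUnitContent_of_map_eq _ _ hιcg hcertϖ, hιcg⟩
  rw [hchar]
  exact (Ideal.span_singleton_mul_left_unit (hcu.map PowerSeries.C) g).symm

/-! ### §2 Transfer to the multiplicative curve; Mazur's statement at the pair -/

/-- **`MultiplicativeCharIdealMuZero W 3`** — EPW Cor. 5.1.4 at an odd prime (`hEPW`, good ⟶ mult) applied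
to §1's identity at the partner (the equivariant isomorphism inverted, irreducibility transported).
[cite: EmertonPollackWeston2006, Cor. 5.1.4 and Thm. 5.1.3 (arXiv:math/0404484 p. 30)]
[cite: YanZhu2024MainConjNonCM, Thm. 4.9 (§4.4; v4 Thm. 5.2)] -/
theorem multiplicativeCharIdealMuZero_three_of_partner
    (hEPW : cor514_transfer_of_goodOrdinary_odd)
    (hYZ : YanZhu2026.thm49_charIdeal_eq_padicLFunction) (h3 : realPeriodRat_eq_unit_mul_plusPeriod_three)
    (hTa : thm1_muAlg_transfer_goodOrdinary_of_mult_odd) (hTn : thm1_muAn_transfer_goodOrdinary_of_mult_odd)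
    (hpar : nonempty_modularParametrizationData)
    (hmult : W.HasMultiplicativeReductionAtPrime 3) (hirr : W.HasIrreducibleModPGaloisRep 3)
    (hdiv : X11b.MultDivisibilityAt W 3) (hμ : X11a.MuAnZeroAt W 3)
    (hgoodA : A.HasGoodReductionAtPrime 3) (hordA : ¬ ((3 : ℕ) : ℤ) ∣ A.frobeniusTrace 3)
    (hiso : ∃ e : geomTorsion W ((3 : ℕ) : ℤ) ≃+ geomTorsion A ((3 : ℕ) : ℤ),
      ∀ (σ : Field.absoluteGaloisGroup ℚ) (P : geomTorsion W ((3 : ℕ) : ℤ)), e (σ • P) = σ • e P) :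
    MultiplicativeCharIdealMuZero W 3 := by
  obtain ⟨e, he⟩ := hiso
  have hirrA : A.HasIrreducibleModPGaloisRep 3 := hasIrreducibleModPGaloisRep_of_torsionIso e he hirr
  exact hEPW A W 3 (by decide) hgoodA hordA hmult ⟨e.symm, torsionIso_symm_smul e he⟩ hirrA
    (goodOrdinaryCharIdealMuZero_three_of_partner W A hYZ h3 hTa hTn hpar hmult hirr hdiv hμ hgoodA hordA
      ⟨e, he⟩)

omit [W.IsGloballyMinimal] in
/-- **Mazur's statement at the pair from the EPW/Skinner shape** (any `p`): `MultiplicativeCharIdealMuZero W p`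
is `X2.MazurMainConjectureAt W p` plus `μ = 0`, up to the idle premise `ϖ ≠ 0` — automatic since `Ω⁺_f > 0`
(`X2.varpi_ne_zero_of_isNewformOf`). Pure bookkeeping. [cite: EmertonPollackWeston2006, statement 5.1.1 (arXiv p. 30) (shape)]
[cite: Skinner2016PacificMC, Thm. A (§1), §3.2 (shape)] -/
theorem mazurMainConjectureAt_of_multiplicativeCharIdealMuZero [W.IsGloballyMinimal] (p : ℕ) [Fact p.Prime]
    (hMC : MultiplicativeCharIdealMuZero W p) : X2.MazurMainConjectureAt W p := by
  intro κ γ hκ hγ hγ' N _ f hf D ϖ hϖ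
  have hϖ0 : ϖ ≠ 0 := X2.varpi_ne_zero_of_isNewformOf hf hϖ
  obtain ⟨htors, g, hchar, -, hsp, hnsp⟩ := hMC κ γ f hκ hγ hγ' hf D ϖ hϖ0 hϖ
  exact ⟨htors, g, hchar, hsp, hnsp⟩

end Partner

/-! ### §3 THE LOWER HALF at an X11a pair with `p = 3` and a good-ordinary `3`-congruent partner -/

section Doors

variable {W : WeierstrassCurve ℚ} [W.IsElliptic] [W.IsGloballyMinimal] {p : ℕ} [Fact p.Prime]
  (A : WeierstrassCurve ℚ) [A.IsElliptic] [A.IsGloballyMinimal]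

/-- **The lower half at an X11a pair with `p = 3`, EITHER image, from a partner, the typed divisibility and
named facts** (EPW ×3 odd, Yan–Zhu 4.9, period unit at 3, Mazur's Manin constant for `μ^an(E,3) = 0`,
Stein–Wuthrich 6.1 ×2, GZK, GS at the pair, modularity): §2 ⟹ `X2.MazurMainConjectureAt W 3` ⟹ `BSD(E,3)`
(height-free socket) ⟹ `Typed.MissingLowerBoundAt W 3`. PER PAIR; CONDITIONAL; closes nothing class-wide.
[cite: EmertonPollackWeston2006, Thm. 1, Cor. 5.1.4] [cite: YanZhu2024MainConjNonCM, Thm. 4.9]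
[cite: Mazur1978, Cor. 4.1] [cite: SteinWuthrich2013, Thm. 6.1 (p. 20)] [cite: Miller2011LMS, Def. 1.1] -/
theorem _root_.Summit.BirchSwinnertonDyer.Rank1Residual.ClassX11a.missingLowerBoundAt_three_of_partner_of_multDivisibilityAt
    (hNf : exists_isNewformOf) (hEPW : cor514_transfer_of_goodOrdinary_odd)
    (hYZ : YanZhu2026.thm49_charIdeal_eq_padicLFunction) (h3 : realPeriodRat_eq_unit_mul_plusPeriod_three)
    (hTa : thm1_muAlg_transfer_goodOrdinary_of_mult_odd) (hTn : thm1_muAn_transfer_goodOrdinary_of_mult_odd)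
    (hMz : mazur_not_dvd_maninConstant_of_odd)
    (hJs : thm61_splitMultiplicative) (hJn : thm61_nonsplitMultiplicative)
    (hGZK : rank_eq_analyticRank_of_analyticRank_le_one) (hGS : greenberg_stevens (W := W) (p := p))
    (hX : ClassX11a W p) (hp3 : p = 3) (hdiv : X11b.MultDivisibilityAt W p)
    (hgoodA : A.HasGoodReductionAtPrime p) (hordA : ¬ (p : ℤ) ∣ A.frobeniusTrace p)
    (hiso : ∃ e : geomTorsion W (p : ℤ) ≃+ geomTorsion A (p : ℤ),
      ∀ (σ : Field.absoluteGaloisGroup ℚ) (P : geomTorsion W (p : ℤ)), e (σ • P) = σ • e P) :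
    MissingLowerBoundAt W p := by
  subst hp3
  have hmod : hasEntireLFunction_rat := hasEntireLFunction_rat_of_exists_isNewformOf hNf
  have hpar : nonempty_modularParametrizationData :=
    nonempty_modularParametrizationData_of_exists_isNewformOf hNf
      IsNewformOf.exists_maninConstant_ne_zero_holds
  have hμ : X11a.MuAnZeroAt W 3 := MultThreeMuAn.muAnZeroAt_three_of_mult_of_irr hMz W hX.mult hX.irr
  have hMC : X2.MazurMainConjectureAt W 3 :=
    mazurMainConjectureAt_of_multiplicativeCharIdealMuZero W 3
      (multiplicativeCharIdealMuZero_three_of_partner W A hEPW hYZ h3 hTa hTn hpar hX.mult hX.irr hdiv hμ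
        hgoodA hordA hiso)
  exact hX.missingLowerBoundAt_of_bsdp hGZK (bsdp_of_mazurMainConjectureAt_heightFree hJs hJn hGZK hmod hpar hGS hX hMC)

/-- **The lower half at an X11a pair with `p = 3`, `ρ̄_{E,3}` ONTO, from a partner and named facts** — the
typed divisibility from Kato–Wuthrich A32 (`hKato`) under `3`-adic surjectivity (Wuthrich's Lemma 20, `h20`).
[cite: Wuthrich2014, Thm. 3 (p. 382), Cor. 19 and Lemma 20 (p. 399)] [cite: EmertonPollackWeston2006, Cor. 5.1.4]
[cite: YanZhu2024MainConjNonCM, Thm. 4.9] [cite: Miller2011LMS, Def. 1.1] -/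
theorem _root_.Summit.BirchSwinnertonDyer.Rank1Residual.ClassX11a.missingLowerBoundAt_three_of_partner_of_surj
    (hNf : exists_isNewformOf) (hEPW : cor514_transfer_of_goodOrdinary_odd)
    (hYZ : YanZhu2026.thm49_charIdeal_eq_padicLFunction) (h3 : realPeriodRat_eq_unit_mul_plusPeriod_three)
    (hTa : thm1_muAlg_transfer_goodOrdinary_of_mult_odd) (hTn : thm1_muAn_transfer_goodOrdinary_of_mult_odd)
    (hMz : mazur_not_dvd_maninConstant_of_odd)
    (hKato : kato_charIdeal_dvd_multiplicative_of_surjective) (h20 : lemma20_surjective_threeAdic_of_semistable)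
    (hJs : thm61_splitMultiplicative) (hJn : thm61_nonsplitMultiplicative)
    (hGZK : rank_eq_analyticRank_of_analyticRank_le_one) (hGS : greenberg_stevens (W := W) (p := p))
    (hX : ClassX11a W p) (hp3 : p = 3) (hsurj : Surj W p)
    (hgoodA : A.HasGoodReductionAtPrime p) (hordA : ¬ (p : ℤ) ∣ A.frobeniusTrace p)
    (hiso : ∃ e : geomTorsion W (p : ℤ) ≃+ geomTorsion A (p : ℤ),
      ∀ (σ : Field.absoluteGaloisGroup ℚ) (P : geomTorsion W (p : ℤ)), e (σ • P) = σ • e P) :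
    MissingLowerBoundAt W p := by
  have hsurj' : ∀ n : ℕ, W.HasSurjectiveModNGaloisRep (p ^ n : ℕ) := by
    subst hp3
    exact h20 W (Or.inr hX.mult) hsurj
  exact hX.missingLowerBoundAt_three_of_partner_of_multDivisibilityAt A hNf hEPW hYZ h3 hTa hTn hMz hJs hJn hGZK
    hGS hp3 (OddChain.multDivisibilityAt_of_kato_of_surjective_pow hKato hX.ne_two hX.mult hsurj') hgoodA hordA hiso

/-- **The lower half at an X11a pair with `p = 3`, `ρ̄_{E,3}` NOT onto, from a partner and named facts** — the
typed divisibility from Kato 12.4 ∕ §17.13 ×3 ∕ Greenberg 1.5 ∕ Wuthrich Cor. 18 and the certificate.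
[cite: Kato2004Asterisque, Thm. 12.4 (p. 221), §17.13 (pp. 279–280)] [cite: Wuthrich2014, Cor. 18 (p. 398)]
[cite: EmertonPollackWeston2006, Cor. 5.1.4] [cite: YanZhu2024MainConjNonCM, Thm. 4.9] [cite: Miller2011LMS, Def. 1.1] -/
theorem _root_.Summit.BirchSwinnertonDyer.Rank1Residual.ClassX11a.missingLowerBoundAt_three_of_partner_of_not_surj
    (hNf : exists_isNewformOf) (hEPW : cor514_transfer_of_goodOrdinary_odd)
    (hYZ : YanZhu2026.thm49_charIdeal_eq_padicLFunction) (h3 : realPeriodRat_eq_unit_mul_plusPeriod_three)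
    (hTa : thm1_muAlg_transfer_goodOrdinary_of_mult_odd) (hTn : thm1_muAn_transfer_goodOrdinary_of_mult_odd)
    (hMz : mazur_not_dvd_maninConstant_of_odd)
    (h12 : Kato2004.thm12_4) (hns : Kato2004.exists_multDivisibilityInputs_nonsplit)
    (hsp : Kato2004.exists_multDivisibilityInputs_split) (h15 : thm15_isTorsion_multiplicative_rat)
    (h18 : Wuthrich2014.corollary18_padicLFunction_mem_iwasawaAlgebra_multiplicative)
    (hfine : Kato2004.exists_multDivisibilityInputs_fine)
    (hJs : thm61_splitMultiplicative) (hJn : thm61_nonsplitMultiplicative)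
    (hGZK : rank_eq_analyticRank_of_analyticRank_le_one) (hGS : greenberg_stevens (W := W) (p := p))
    (hX : ClassX11a W p) (hp3 : p = 3) (hnsj : ¬ Surj W p)
    (hgoodA : A.HasGoodReductionAtPrime p) (hordA : ¬ (p : ℤ) ∣ A.frobeniusTrace p)
    (hiso : ∃ e : geomTorsion W (p : ℤ) ≃+ geomTorsion A (p : ℤ),
      ∀ (σ : Field.absoluteGaloisGroup ℚ) (P : geomTorsion W (p : ℤ)), e (σ • P) = σ • e P) :
    MissingLowerBoundAt W p := by
  have hμ : X11a.MuAnZeroAt W p := by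
    subst hp3
    exact MultThreeMuAn.muAnZeroAt_three_of_mult_of_irr hMz W hX.mult hX.irr
  exact hX.missingLowerBoundAt_three_of_partner_of_multDivisibilityAt A hNf hEPW hYZ h3 hTa hTn hMz hJs hJn hGZK
    hGS hp3 (hX.multDivisibilityAt_of_muAnZeroAt_of_not_surj h12 hns hsp h15 h18 hfine hnsj hμ) hgoodA hordA hiso

/-- **The lower half at an X11a pair with `p = 3`, ANY image, from a good-ordinary `3`-congruent partner and
named facts** (case split on `Surj W 3`). PER PAIR; CONDITIONAL; closes nothing class-wide.
[cite: EmertonPollackWeston2006, Thm. 1, Cor. 5.1.4 (arXiv:math/0404484 pp. 2, 30)] [cite: YanZhu2024MainConjNonCM, Thm. 4.9]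
[cite: Wuthrich2014, Cor. 18, Lemma 20] [cite: Kato2004Asterisque, Thm. 12.4, §17.13] [cite: Miller2011LMS, Def. 1.1] -/
theorem _root_.Summit.BirchSwinnertonDyer.Rank1Residual.ClassX11a.missingLowerBoundAt_three_of_partner_of_facts
    (hNf : exists_isNewformOf) (hEPW : cor514_transfer_of_goodOrdinary_odd)
    (hYZ : YanZhu2026.thm49_charIdeal_eq_padicLFunction) (h3 : realPeriodRat_eq_unit_mul_plusPeriod_three)
    (hTa : thm1_muAlg_transfer_goodOrdinary_of_mult_odd) (hTn : thm1_muAn_transfer_goodOrdinary_of_mult_odd)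
    (hMz : mazur_not_dvd_maninConstant_of_odd)
    (hKato : kato_charIdeal_dvd_multiplicative_of_surjective) (h20 : lemma20_surjective_threeAdic_of_semistable)
    (h12 : Kato2004.thm12_4) (hns : Kato2004.exists_multDivisibilityInputs_nonsplit)
    (hsp : Kato2004.exists_multDivisibilityInputs_split) (h15 : thm15_isTorsion_multiplicative_rat)
    (h18 : Wuthrich2014.corollary18_padicLFunction_mem_iwasawaAlgebra_multiplicative)
    (hfine : Kato2004.exists_multDivisibilityInputs_fine)
    (hJs : thm61_splitMultiplicative) (hJn : thm61_nonsplitMultiplicative)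
    (hGZK : rank_eq_analyticRank_of_analyticRank_le_one) (hGS : greenberg_stevens (W := W) (p := p))
    (hX : ClassX11a W p) (hp3 : p = 3)
    (hgoodA : A.HasGoodReductionAtPrime p) (hordA : ¬ (p : ℤ) ∣ A.frobeniusTrace p)
    (hiso : ∃ e : geomTorsion W (p : ℤ) ≃+ geomTorsion A (p : ℤ),
      ∀ (σ : Field.absoluteGaloisGroup ℚ) (P : geomTorsion W (p : ℤ)), e (σ • P) = σ • e P) :
    MissingLowerBoundAt W p := by
  by_cases hsurj : Surj W p
  · exact hX.missingLowerBoundAt_three_of_partner_of_surj A hNf hEPW hYZ h3 hTa hTn hMz hKato h20 hJs hJn hGZK hGS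
      hp3 hsurj hgoodA hordA hiso
  · exact hX.missingLowerBoundAt_three_of_partner_of_not_surj A hNf hEPW hYZ h3 hTa hTn hMz h12 hns hsp h15 h18
      hfine hJs hJn hGZK hGS hp3 hsurj hgoodA hordA hiso

/-! ### §4 The partner's `E[3] ≃ A[3]` from a finite congruence list (Kraus–Oesterlé Prop. 4) -/

/-- **The lower half at an X11a pair with `p = 3` from a good-ordinary partner `A` given by a FINITE
Kraus–Oesterlé congruence list** (`hKO`, Prop. 4 (ii) ⟹ (i), Hasse–Weil currency: `a_ℓ(E) ≡ a_ℓ(A) (mod 3)` at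
the good primes and the simple-prime congruence, for `ℓ < μ(M)/6`) — the shape a data seat certifies per pair.
[cite: KrausOesterle1992, Prop. 4, pp. 263–264] [cite: EmertonPollackWeston2006, Cor. 5.1.4]
[cite: YanZhu2024MainConjNonCM, Thm. 4.9] [cite: Miller2011LMS, Def. 1.1] -/
theorem _root_.Summit.BirchSwinnertonDyer.Rank1Residual.ClassX11a.missingLowerBoundAt_three_of_partner_of_congruences_of_facts
    (hNf : exists_isNewformOf) (hKO : KrausOesterle1992.prop4_torsionIso_of_congruences_hasseWeil)
    (hEPW : cor514_transfer_of_goodOrdinary_odd)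
    (hYZ : YanZhu2026.thm49_charIdeal_eq_padicLFunction) (h3 : realPeriodRat_eq_unit_mul_plusPeriod_three)
    (hTa : thm1_muAlg_transfer_goodOrdinary_of_mult_odd) (hTn : thm1_muAn_transfer_goodOrdinary_of_mult_odd)
    (hMz : mazur_not_dvd_maninConstant_of_odd)
    (hKato : kato_charIdeal_dvd_multiplicative_of_surjective) (h20 : lemma20_surjective_threeAdic_of_semistable)
    (h12 : Kato2004.thm12_4) (hns : Kato2004.exists_multDivisibilityInputs_nonsplit)
    (hsp : Kato2004.exists_multDivisibilityInputs_split) (h15 : thm15_isTorsion_multiplicative_rat)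
    (h18 : Wuthrich2014.corollary18_padicLFunction_mem_iwasawaAlgebra_multiplicative)
    (hfine : Kato2004.exists_multDivisibilityInputs_fine)
    (hJs : thm61_splitMultiplicative) (hJn : thm61_nonsplitMultiplicative)
    (hGZK : rank_eq_analyticRank_of_analyticRank_le_one) (hGS : greenberg_stevens (W := W) (p := p))
    (hX : ClassX11a W p) (hp3 : p = 3)
    (hgoodA : A.HasGoodReductionAtPrime p) (hordA : ¬ (p : ℤ) ∣ A.frobeniusTrace p)
    (hcong : ∀ (ℓ : ℕ) [Fact ℓ.Prime], 6 * ℓ < KrausOesterle1992.gammaZeroIndex (KrausOesterle1992.modulus W A) →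
      (padicValNat ℓ (W.conductorNorm ℤ * A.conductorNorm ℤ) = 0 →
          (p : ℤ) ∣ W.frobeniusTrace ℓ - A.frobeniusTrace ℓ) ∧
        (padicValNat ℓ (W.conductorNorm ℤ * A.conductorNorm ℤ) = 1 →
          (p : ℤ) ∣ W.LFunction ℓ * A.LFunction ℓ - (ℓ + 1))) :
    MissingLowerBoundAt W p :=
  hX.missingLowerBoundAt_three_of_partner_of_facts A hNf hEPW hYZ h3 hTa hTn hMz hKato h20 h12 hns hsp h15 h18 hfine
    hJs hJn hGZK hGS hp3 hgoodA hordA (hKO W A p hX.irr hcong)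

end Doors

end Summit.BirchSwinnertonDyer.BirchSwinnertonDyer.Theorems.ThreePartner

end
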